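import Literature.AlgebraicTopology.SingularHomology.CupRightMayerVietoris
import Literature.AlgebraicTopology.SingularHomology.SubsetCochainsPullback
import HarnessLib

/-!
# `⌣ β` on the cohomology of subsets: pull-backs and change of the cocycle

Topic `Literature/AlgebraicTopology/SingularHomology`. A. Hatcher, *Algebraic Topology* (2002),
§3.2 Prop. 3.10 (`f*(a ⌣ b) = f*a ⌣ f*b`), Lemma 3.6 (the Leibniz rule), §3.1 p. 199 (induced
cochain maps); D. Husemoller, *Fibre Bundles*, Ch. 17 §1 (proof of Thm. 1.1: the comparison maps
`θ` are natural under maps of the total space, and only depend on the classes `aᵢ`).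

Complements to the tree's right action `⌣ β` of global cochains on the cochains of subsets
(`CupRightAction.lean`, `CupRightMayerVietoris.lean`) and the pull-back `subsetCochains.pull`
(`SubsetCochainsPullback.lean`).  PROVED here:

* `SimplexSpan.d_cupRight_add` — the full Leibniz rule `δ(ψ ⌣ α) = δψ ⌣ α + (-1)ᵖ ψ ⌣ δα`;
* `SimplexSpan.cupRight_add_right`, `cupRight_smul_right` — linearity in the global cochain;
* `SimplexSpan.cupRightH_congr` — **`⌣ β = ⌣ β'` on cohomology for cohomologous cocycles**
  `β - β' = δα`;
* `subsetCochains.toFun_pull`, `subsetCochains.pull_cupRight`, `subsetCochains.pullH_cupRightH` —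
  **`f*(y ⌣ β) = f*y ⌣ f^♯β`**;
* `subsetCochains.pull_comp`, `subsetCochains.pullH_pullH` — functoriality of the pull-back.

Everything is proved; no named facts.

## References

* [HatcherAT2002] A. Hatcher, *Algebraic Topology*, CUP 2002, §3.2 Prop. 3.10, Lemma 3.6; §3.1 p. 199.
* [HusemollerFibreBundles1994] D. Husemoller, *Fibre Bundles*, 3rd ed. (1994), Ch. 17 §1 Thm. 1.1.
-/

noncomputable section

-- as in `CupRightAction` / `CupRightMayerVietoris`: chains of the concrete complex are `Finsupp`s
-- up to unfolding of semireducible definitions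
set_option backward.isDefEq.respectTransparency false

open CategoryTheory Limits

universe u v

namespace Literature.AlgebraicTopology.SingularHomology

namespace SimplexSpan

variable {R : Type v} [CommRing R] {X : Type u} [TopologicalSpace X]

/-- Local notation: the coefficient object `R` of `ModuleCat.{max u v} R`. -/
local notation "𝑹" => SimplexSpan.coefR R

variable (𝒮 : SimplexSpan R X)

/-! ### Leibniz rule and linearity in the global cochain -/

/-- **Leibniz rule** `δ(ψ ⌣ α) = δψ ⌣ α + (-1)ᵖ ψ ⌣ δα` for the right action of an arbitrary global
cochain `α ∈ Cᵈ(X; R)` (Hatcher 2002, Lemma 3.6, restricted to the family).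
[cite: HatcherAT2002, Lemma 3.6] -/
theorem d_cupRight_add (hS : 𝒮.FrontBackClosed) {p d n : ℕ} (α : SingularSimplex X d → R)
    (h : p + d = n) (ψ : 𝒮.sub.toComplex.X p ⟶ 𝑹) :
    𝒮.cochains.d n (n + 1) (𝒮.cupRight α h ψ) =
      𝒮.cupRight α (show (p + 1) + d = n + 1 by omega) (𝒮.cochains.d p (p + 1) ψ) +
        (-1 : R) ^ p • 𝒮.cupRight ((singularCochainComplex R R X).d d (d + 1) α)
          (show p + (d + 1) = n + 1 by omega) ψ := by
  refine 𝒮.hom_ext_toFun fun τ hτ ↦ ?_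
  rw [𝒮.toFun_d _ hτ, 𝒮.toFun_add, 𝒮.toFun_smul, Pi.add_apply, Pi.smul_apply,
    𝒮.toFun_cupRight _ _ _ hτ, 𝒮.toFun_cupRight _ _ _ hτ, cochainCup_apply, cochainCup_apply,
    𝒮.toFun_d _ (hS.front _ hτ)]
  have hloc : (singularCochainComplex R R X).d n (n + 1) (𝒮.toFun (𝒮.cupRight α h ψ)) τ =
      (singularCochainComplex R R X).d n (n + 1) (cochainCup h (𝒮.toFun ψ) α) τ := by
    rw [singularCochainComplex.d_apply, singularCochainComplex.d_apply]
    refine Finset.sum_congr rfl fun i _ ↦ ?_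
    rw [𝒮.toFun_cupRight _ _ _ (𝒮.face_mem' hτ i)]
  rw [hloc, d_cochainCup h, Pi.add_apply, Pi.smul_apply, cochainCup_apply, cochainCup_apply]

/-- `⌣` is additive in the global cochain. [folklore] -/
theorem cupRight_add_right {p d n : ℕ} (β β' : SingularSimplex X d → R) (h : p + d = n)
    (ψ : 𝒮.sub.toComplex.X p ⟶ 𝑹) :
    𝒮.cupRight (β + β') h ψ = 𝒮.cupRight β h ψ + 𝒮.cupRight β' h ψ := by
  refine 𝒮.hom_ext_toFun fun τ hτ ↦ ?_
  rw [𝒮.toFun_add, Pi.add_apply, 𝒮.toFun_cupRight _ _ _ hτ, 𝒮.toFun_cupRight _ _ _ hτ,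
    𝒮.toFun_cupRight _ _ _ hτ, map_add, Pi.add_apply]

/-- `⌣` is homogeneous in the global cochain. [folklore] -/
theorem cupRight_smul_right {p d n : ℕ} (r : R) (β : SingularSimplex X d → R) (h : p + d = n)
    (ψ : 𝒮.sub.toComplex.X p ⟶ 𝑹) :
    𝒮.cupRight (r • β) h ψ = r • 𝒮.cupRight β h ψ := by
  refine 𝒮.hom_ext_toFun fun τ hτ ↦ ?_
  rw [𝒮.toFun_smul, Pi.smul_apply, 𝒮.toFun_cupRight _ _ _ hτ, 𝒮.toFun_cupRight _ _ _ hτ,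
    map_smul, Pi.smul_apply]

/-- `⌣` of a difference of global cochains. [folklore] -/
theorem cupRight_sub_right {p d n : ℕ} (β β' : SingularSimplex X d → R) (h : p + d = n)
    (ψ : 𝒮.sub.toComplex.X p ⟶ 𝑹) :
    𝒮.cupRight (β - β') h ψ = 𝒮.cupRight β h ψ - 𝒮.cupRight β' h ψ := by
  rw [sub_eq_add_neg, cupRight_add_right, ← neg_one_smul R β', cupRight_smul_right, neg_one_smul,
    ← sub_eq_add_neg]

/-- `0 ⌣ β = 0`. [folklore] -/
theorem cupRight_zero {p d n : ℕ} (β : SingularSimplex X d → R) (h : p + d = n) :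
    𝒮.cupRight β h (0 : 𝒮.sub.toComplex.X p ⟶ 𝑹) = 0 :=
  (𝒮.cupRightₗ β h).map_zero

/-- **`⌣ β` on cohomology only depends on the class of `β`**: if `β - β' = δα` for cocycles
`β`, `β'` then `[ψ] ⌣ β = [ψ] ⌣ β'` (`ψ ⌣ δα = ±δ(ψ ⌣ α)` for a cocycle `ψ`; Hatcher 2002, proof
of Lemma 3.6 ff.). [cite: HatcherAT2002, Lemma 3.6] -/
theorem cupRightH_congr (hS : 𝒮.FrontBackClosed) {p d n : ℕ} (β β' : SingularSimplex X (d + 1) → R)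
    (hβ : (singularCochainComplex R R X).d (d + 1) (d + 1 + 1) β = 0)
    (hβ' : (singularCochainComplex R R X).d (d + 1) (d + 1 + 1) β' = 0)
    (α : SingularSimplex X d → R) (hα : β - β' = (singularCochainComplex R R X).d d (d + 1) α)
    (h : p + (d + 1) = n) (x : 𝒮.cochains.homology p) :
    𝒮.cupRightH hS β hβ h x = 𝒮.cupRightH hS β' hβ' h x := by
  obtain ⟨ψ, hψ, rfl⟩ := homologyCls_surjective x
  have hψ' : 𝒮.cochains.d p (p + 1) ψ = 0 := (d_next_eq_zero_iff (symm_down_next p) _).1 hψ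
  have hz := 𝒮.d_next_cupRight_eq_zero hS β hβ h ψ hψ
  have hz' := 𝒮.d_next_cupRight_eq_zero hS β' hβ' h ψ hψ
  have hdiff : 𝒮.cochains.d n ((ComplexShape.down ℕ).symm.next n)
      (𝒮.cupRight β h ψ - 𝒮.cupRight β' h ψ) = 0 := by
    rw [map_sub, hz, hz', sub_zero]
  rw [𝒮.cupRightH_homologyCls hS β hβ h ψ hψ, 𝒮.cupRightH_homologyCls hS β' hβ' h ψ hψ, ← sub_eq_zero,
    ← homologyCls_sub _ _ hz hz' hdiff]
  -- `ψ ⌣ β - ψ ⌣ β' = ψ ⌣ δα = (-1)ᵖ (-1)ᵖ … = ± δ(ψ ⌣ α)`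
  obtain _ | m := n
  · omega
  · have hm : p + d = m := by omega
    have hL := 𝒮.d_cupRight_add hS α hm ψ
    rw [hψ', 𝒮.cupRight_zero, zero_add] at hL
    -- so `(-1)^p • (ψ ⌣ δα) = δ(ψ ⌣ α)` and `ψ ⌣ δα = (-1)^p • δ(ψ ⌣ α)`
    have hkey : 𝒮.cupRight β h ψ - 𝒮.cupRight β' h ψ =
        𝒮.cochains.d m (m + 1) ((-1 : R) ^ p • 𝒮.cupRight α hm ψ) := by
      rw [← 𝒮.cupRight_sub_right, hα, map_smul, hL, smul_smul, ← mul_pow, neg_one_mul, neg_neg,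
        one_pow, one_smul]
    have hd2 : 𝒮.cochains.d (m + 1) ((ComplexShape.down ℕ).symm.next (m + 1))
        (𝒮.cochains.d m (m + 1) ((-1 : R) ^ p • 𝒮.cupRight α hm ψ)) = 0 := by
      rw [← ModuleCat.comp_apply, HomologicalComplex.d_comp_d]
      rfl
    exact (homologyCls_congr hkey _ hd2).trans (homologyCls_d_eq_zero_symm m _ hd2)

end SimplexSpan

/-! ### Pull-back and `⌣ β` -/

namespace subsetCochains

variable {R : Type v} [CommRing R] {X Y : Type u} [TopologicalSpace X] [TopologicalSpace Y]
  (f : C(X, Y))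

/-- Local notation: the coefficient object `R` of `ModuleCat.{max u v} R`. -/
local notation "𝑹" => SimplexSpan.coefR R

/-- **The function cochain of a pulled-back cochain**: `(f^♯ψ)(σ) = ψ(f ∘ σ)` on the simplices of
`U` (Hatcher 2002, §3.1 p. 199). [cite: HatcherAT2002, §3.1 p. 199] -/
theorem toFun_pull {U : Set X} {V : Set Y} (h : Set.MapsTo f U V) {k : ℕ}
    (ψ : (subsetCochains R 𝑹 V).X k) {σ : SingularSimplex X k} (hσ : σ.range ⊆ U) :
    (SimplexSpan.ofSet (R := R) U).toFun ((pull R 𝑹 f h).f k ψ) σ =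
      (SimplexSpan.ofSet (R := R) V).toFun ψ (SingularSimplex.map f σ) := by
  have hσ' : (SingularSimplex.map f σ).range ⊆ V := by
    rw [SingularSimplex.range_map]
    rintro _ ⟨x, hx, rfl⟩
    exact h (hσ hx)
  rw [(SimplexSpan.ofSet (R := R) U).toFun_apply_of_mem _ hσ,
    (SimplexSpan.ofSet (R := R) V).toFun_apply_of_mem _ hσ', dualMap_f_apply, ModuleCat.comp_apply]
  congr 2
  apply Subtype.ext
  change (csingularChainComplex.map R R f).f k (Finsupp.single σ 1) = Finsupp.single (SingularSimplex.map f σ) 1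
  exact csingularChainComplex.map_f_single f σ 1

/-- **Pull-back commutes with `⌣`: `f^♯(ψ ⌣ β) = f^♯ψ ⌣ f^♯β`** on the cochains of subsets
(Hatcher 2002, proof of Prop. 3.10: faces commute with `f`). [cite: HatcherAT2002, §3.2 Prop. 3.10] -/
theorem pull_cupRight {U : Set X} {V : Set Y} (h : Set.MapsTo f U V) {p d n : ℕ} (hpd : p + d = n)
    (β : SingularSimplex Y d → R) (ψ : (subsetCochains R 𝑹 V).X p) :
    (pull R 𝑹 f h).f n ((SimplexSpan.ofSet (R := R) V).cupRight β hpd ψ) =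
      (SimplexSpan.ofSet (R := R) U).cupRight ((singularCochainComplex.map R R f).f d β) hpd
        ((pull R 𝑹 f h).f p ψ) := by
  refine (SimplexSpan.ofSet (R := R) U).hom_ext_toFun fun σ hσ ↦ ?_
  have hσ' : (SingularSimplex.map f σ).range ⊆ V := by
    rw [SingularSimplex.range_map]
    rintro _ ⟨x, hx, rfl⟩
    exact h (hσ hx)
  rw [toFun_pull f h _ hσ, (SimplexSpan.ofSet (R := R) V).toFun_cupRight_eq β hpd ψ hσ',
    (SimplexSpan.ofSet (R := R) U).toFun_cupRight_eq _ hpd _ hσ, singularCochainComplex.map_apply,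
    SingularSimplex.frontFace_map, SingularSimplex.backFace_map,
    toFun_pull f h _ ((SimplexSpan.frontBackClosed_ofSet U).front _ hσ)]

/-- The pull-back of a cocycle is a cocycle. [folklore] -/
theorem map_d_eq_zero {d : ℕ} (β : SingularSimplex Y d → R)
    (hβ : (singularCochainComplex R R Y).d d (d + 1) β = 0) :
    (singularCochainComplex R R X).d d (d + 1) ((singularCochainComplex.map R R f).f d β) = 0 := by
  rw [← ModuleCat.comp_apply, (singularCochainComplex.map R R f).comm d (d + 1), ModuleCat.comp_apply, hβ,
    map_zero]

/-- **`f*(y ⌣ β) = f*y ⌣ f^♯β` on the cohomology of subsets** (Hatcher 2002, Prop. 3.10;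
Husemoller Ch. 17 §1: naturality of the comparison maps `θ`). [cite: HatcherAT2002, §3.2 Prop. 3.10] -/
theorem pullH_cupRightH {U : Set X} {V : Set Y} (h : Set.MapsTo f U V) {p d n : ℕ} (hpd : p + d = n)
    (β : SingularSimplex Y d → R) (hβ : (singularCochainComplex R R Y).d d (d + 1) β = 0)
    (y : (subsetCochains R 𝑹 V).homology p) :
    pullH (N := 𝑹) f h n ((SimplexSpan.ofSet (R := R) V).cupRightH (SimplexSpan.frontBackClosed_ofSet _)
        β hβ hpd y) =
      (SimplexSpan.ofSet (R := R) U).cupRightH (SimplexSpan.frontBackClosed_ofSet _)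
        ((singularCochainComplex.map R R f).f d β) (map_d_eq_zero f β hβ) hpd (pullH (N := 𝑹) f h p y) := by
  obtain ⟨ψ, hψ, rfl⟩ := homologyCls_surjective y
  rw [(SimplexSpan.ofSet (R := R) V).cupRightH_homologyCls]
  change HomologicalComplex.homologyMap (pull R 𝑹 f h) n (homologyCls _ _) =
    (SimplexSpan.ofSet (R := R) U).cupRightH _ _ _ hpd
      (HomologicalComplex.homologyMap (pull R 𝑹 f h) p (homologyCls ψ hψ))
  rw [homologyMap_homologyCls, homologyMap_homologyCls, (SimplexSpan.ofSet (R := R) U).cupRightH_homologyCls]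
  exact homologyCls_congr (pull_cupRight f h hpd β ψ) _ _

/-! ### Functoriality of the pull-back -/

variable {Z : Type u} [TopologicalSpace Z] (g : C(Y, Z))

/-- **`(g ∘ f)^♯ = f^♯ ∘ g^♯`** on the cochains of subsets. [cite: HatcherAT2002, §3.1 p. 199] -/
theorem pull_comp {U : Set X} {V : Set Y} {W : Set Z} (hf : Set.MapsTo f U V) (hg : Set.MapsTo g V W)
    (hgf : Set.MapsTo (g.comp f) U W) :
    pull R 𝑹 (g.comp f) hgf = pull R 𝑹 g hg ≫ pull R 𝑹 f hf := by
  change dualMap R 𝑹 _ = dualMap R 𝑹 _ ≫ dualMap R 𝑹 _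
  rw [← dualMap_comp]
  have hc : csingularChainComplex.map R R (g.comp f) =
      csingularChainComplex.map R R f ≫ csingularChainComplex.map R R g :=
    csingularChainComplex.map_comp f g
  change dualMap R 𝑹 (Subcomplex.subMap _ _ _ _) = dualMap R 𝑹 (Subcomplex.subMap _ _ _ _ ≫ Subcomplex.subMap _ _ _ _)
  rw [← Subcomplex.subMap_comp]
  · rw [Subcomplex.subMap_congr hc]
  · exact (chainsInSub_le_comap_map R R f hf).trans (by
      intro i x hx
      rw [Subcomplex.mem_comap] at hx ⊢
      rw [hc, HomologicalComplex.comp_f, ModuleCat.comp_apply] at *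
      exact (chainsInSub_le_comap_map R R g hg) i hx)

/-- **`(g ∘ f)* = f* ∘ g*`** on the cohomology of subsets, elementwise. [cite: HatcherAT2002, §3.1 p. 199] -/
theorem pullH_pullH {U : Set X} {V : Set Y} {W : Set Z} (hf : Set.MapsTo f U V) (hg : Set.MapsTo g V W)
    (hgf : Set.MapsTo (g.comp f) U W) (p : ℕ) (z : (subsetCochains R 𝑹 W).homology p) :
    pullH (N := 𝑹) f hf p (pullH (N := 𝑹) g hg p z) = pullH (N := 𝑹) (g.comp f) hgf p z := by
  rw [← ModuleCat.comp_apply, ← HomologicalComplex.homologyMap_comp, ← pull_comp f g hf hg hgf]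

end subsetCochains

end Literature.AlgebraicTopology.SingularHomology
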